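import Literature.NumberTheory.Automorphic.ArchKirillovStringGL2Complex
import HarnessLib

/-!
# Descent of `SU(2)`-types at a complex place of `GL₂(K_∞)`: the algebra (Jacquet–Langlands (1970), §6)

Topic `NumberTheory/Automorphic`; namespace `Literature.NumberTheory.Automorphic`. Theorems only (no
definition, no named fact, no instance). Notation at a complex place `w` as in
`ArchKirillovStringGL2Complex`: `τ^h(E_{ij})`, `τ^a(E_{ij})`, `T`, `E = τ^h(E₀₁) - τ^a(E₁₀)`,
`F = τ^h(E₁₀) - τ^a(E₀₁)`, and the three `𝔭`-operators

  `P⁻ = τ^h(E₁₀) + τ^a(E₀₁)`, `P⁰ = 2(τ^h(E₀₀) - τ^h(E₁₁)) + 2(τ^a(E₀₀) - τ^a(E₁₁))`, `P⁺ = τ^h(E₀₁) + τ^a(E₁₀)`.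

1. `gardingEndHol_mul_eq`, `gardingEndAnti_mul_eq` — the holomorphic (antiholomorphic) letters satisfy
   *twice* the `𝔤𝔩₂` relations: `[τ^h(E_{ij}), τ^h(E_{kl})] = 2(δ_{jk} τ^h(E_{il}) - δ_{li} τ^h(E_{kj}))`.
2. `raisingK_mul_pMinus/pZero/pPlus` — `[E, P⁻] = P⁰`, `[E, P⁰] = -8 P⁺`, `[E, P⁺] = 0`;
   `torusC_mul_pMinus/pZero/pPlus` — `[τ(T), P⁻] = -2i P⁻`, `[τ(T), P⁰] = 0`, `[τ(T), P⁺] = 2i P⁺`.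
3. `descent_highest` — for a highest-weight vector `x` of torus weight `m ∉ {0, 1}` the **descent vector**
   `x' = P⁻ x - (4m)⁻¹ P⁰ F x - (4m(m-1))⁻¹ P⁺ F² x` is again a highest-weight vector, of weight `m - 2`
   (`E x' = 0`, `τ(T) x' = i(m-2) x'`): the projection of `𝔭 ⊗ V_m → V_{m-2}`.
4. `exists_nat_weight_of_highest` — in a finite-dimensional `K_∞`-stable subspace, a non-zero highest-weight
   vector has weight `m ∈ ℕ`, its string `F^j x` (`j ≤ m`) is non-zero and `F^{m+1} x = 0`.

## References

* H. Jacquet, R. P. Langlands, *Automorphic Forms on GL(2)*, LNM 114 (1970), §6. [JacquetLanglands1970]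
* A. W. Knapp, *Representation Theory of Semisimple Groups* (1986), Ch. II §5, Ch. VIII §3. [Knapp1986]
-/

noncomputable section

open MeasureTheory Measure NumberField NumberField.InfinitePlace NumberField.mixedEmbedding IsDedekindDomain Set Filter
open scoped MatrixGroups Topology Classical

namespace Literature.NumberTheory.Automorphic

variable {K : Type} [Field K] [NumberField K]

-- as in `ArchGardingWhittaker`
set_option backward.isDefEq.respectTransparency false

omit [NumberField K] in
/-- `E_{ij} ⊗ x · E_{kl} ⊗ y = δ_{jk} E_{il} ⊗ xy`. [folklore] -/
theorem single_mul_single_eq (i j k l : Fin 2) (x y : mixedSpace K) :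
    Matrix.single i j x * Matrix.single k l y = if j = k then Matrix.single i l (x * y) else 0 := by
  split_ifs with h
  · subst h; exact Matrix.single_mul_single_same (c := x) i j l y
  · exact Matrix.single_mul_single_of_ne (c := x) i j k h y

section Place

variable {hcpt : isCompact_glFiniteIntegralLevel 2 K}
  {E : Type*} [NormedAddCommGroup E] [NormedSpace ℂ E] [CompleteSpace E]
  {τ : ContRepresentation ℂ (AutomorphyDatum.gl 2 K hcpt).arch.carrier E}
  (hτ : τ.IsStronglyContinuous) (w : {w : InfinitePlace K // IsComplex w})

local notation "𝐜" => ((0, Pi.single w 1) : mixedSpace K)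
local notation "𝐜I" => ((0, Pi.single w Complex.I) : mixedSpace K)
local notation "D" => gardingEnd (hcpt := hcpt) (τ := τ) hτ
local notation "Dh[" i "," j "]" => (gardingEnd (hcpt := hcpt) (τ := τ) hτ (Matrix.single (i : Fin 2) (j : Fin 2) ((0, Pi.single w 1) : mixedSpace K)) -
  Complex.I • gardingEnd (hcpt := hcpt) (τ := τ) hτ (Matrix.single (i : Fin 2) (j : Fin 2) ((0, Pi.single w Complex.I) : mixedSpace K)))
local notation "Da[" i "," j "]" => (gardingEnd (hcpt := hcpt) (τ := τ) hτ (Matrix.single (i : Fin 2) (j : Fin 2) ((0, Pi.single w 1) : mixedSpace K)) +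
  Complex.I • gardingEnd (hcpt := hcpt) (τ := τ) hτ (Matrix.single (i : Fin 2) (j : Fin 2) ((0, Pi.single w Complex.I) : mixedSpace K)))
local notation "Tc" => (Matrix.single (0 : Fin 2) (0 : Fin 2) ((0, Pi.single w Complex.I) : mixedSpace K) -
  Matrix.single (1 : Fin 2) (1 : Fin 2) ((0, Pi.single w Complex.I) : mixedSpace K))

/-! ### 1. The holomorphic and antiholomorphic letters satisfy twice the `𝔤𝔩₂` relations -/

/-- **`[τ^h(E_{ij}), τ^h(E_{kl})] = 2(δ_{jk} τ^h(E_{il}) - δ_{li} τ^h(E_{kj}))`.** [cite: Knapp1986, Ch. VIII §3] -/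
theorem gardingEndHol_mul_eq (i j k l : Fin 2) :
    Dh[i,j] * Dh[k,l] = Dh[k,l] * Dh[i,j] +
      (2 : ℂ) • ((if j = k then Dh[i,l] else 0) - (if l = i then Dh[k,j] else 0)) := by
  have hcc := complexIdem_mul_self (K := K) w
  have hci := complexIdem_mul_complexIdemI (K := K) w
  have hic := complexIdemI_mul_complexIdem (K := K) w
  have hii := complexIdemI_mul_self (K := K) w
  have key : ∀ x y : mixedSpace K, D (Matrix.single i j x) * D (Matrix.single k l y) =
      D (Matrix.single k l y) * D (Matrix.single i j x) + D (Matrix.single i j x * Matrix.single k l y - Matrix.single k l y * Matrix.single i j x) :=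
    fun x y => gardingEnd_mul_eq hτ _ _
  have e1 := key 𝐜 𝐜
  have e2 := key 𝐜 𝐜I
  have e3 := key 𝐜I 𝐜
  have e4 := key 𝐜I 𝐜I
  simp only [single_mul_single_eq, hcc, hci, hic, hii] at e1 e2 e3 e4
  rw [sub_mul, mul_sub, mul_sub, smul_mul_assoc, smul_mul_assoc, mul_smul_comm, mul_smul_comm, e1, e2, e3, e4]
  have hI : Complex.I * Complex.I = -1 := Complex.I_mul_I
  by_cases hjk : j = k <;> by_cases hli : l = i
  · subst hjk; subst hli
    simp only [if_true, ← Matrix.single_neg, gardingEnd_sub, gardingEnd_neg, sub_mul, mul_sub, smul_mul_assoc,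
      mul_smul_comm, smul_add, smul_sub, smul_smul, hI, smul_neg, neg_smul, one_smul]
    module
  · subst hjk
    simp only [if_true, if_neg hli, sub_zero, ← Matrix.single_neg, gardingEnd_neg, sub_mul, mul_sub, smul_mul_assoc,
      mul_smul_comm, smul_add, smul_sub, smul_smul, hI, smul_neg, neg_smul, one_smul]
    module
  · subst hli
    simp only [if_true, if_neg hjk, zero_sub, ← Matrix.single_neg, gardingEnd_neg, sub_mul, mul_sub, smul_mul_assoc,
      mul_smul_comm, smul_add, smul_sub, smul_smul, hI, smul_neg, neg_smul, one_smul, neg_neg]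
    module
  · simp only [if_neg hjk, if_neg hli, sub_zero, gardingEnd_zero, sub_mul, mul_sub, smul_mul_assoc, mul_smul_comm,
      smul_sub, smul_smul, hI, smul_zero, add_zero, neg_smul, one_smul]

/-- **`[τ^a(E_{ij}), τ^a(E_{kl})] = 2(δ_{jk} τ^a(E_{il}) - δ_{li} τ^a(E_{kj}))`.** [cite: Knapp1986, Ch. VIII §3] -/
theorem gardingEndAnti_mul_eq (i j k l : Fin 2) :
    Da[i,j] * Da[k,l] = Da[k,l] * Da[i,j] +
      (2 : ℂ) • ((if j = k then Da[i,l] else 0) - (if l = i then Da[k,j] else 0)) := by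
  have hcc := complexIdem_mul_self (K := K) w
  have hci := complexIdem_mul_complexIdemI (K := K) w
  have hic := complexIdemI_mul_complexIdem (K := K) w
  have hii := complexIdemI_mul_self (K := K) w
  have key : ∀ x y : mixedSpace K, D (Matrix.single i j x) * D (Matrix.single k l y) =
      D (Matrix.single k l y) * D (Matrix.single i j x) + D (Matrix.single i j x * Matrix.single k l y - Matrix.single k l y * Matrix.single i j x) :=
    fun x y => gardingEnd_mul_eq hτ _ _
  have e1 := key 𝐜 𝐜
  have e2 := key 𝐜 𝐜I
  have e3 := key 𝐜I 𝐜
  have e4 := key 𝐜I 𝐜I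
  simp only [single_mul_single_eq, hcc, hci, hic, hii] at e1 e2 e3 e4
  rw [add_mul, mul_add, mul_add, smul_mul_assoc, smul_mul_assoc, mul_smul_comm, mul_smul_comm, e1, e2, e3, e4]
  have hI : Complex.I * Complex.I = -1 := Complex.I_mul_I
  by_cases hjk : j = k <;> by_cases hli : l = i
  · subst hjk; subst hli
    simp only [if_true, ← Matrix.single_neg, gardingEnd_sub, gardingEnd_neg, add_mul, mul_add, smul_mul_assoc,
      mul_smul_comm, smul_add, smul_sub, smul_smul, hI, smul_neg, neg_smul, one_smul]
    module
  · subst hjk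
    simp only [if_true, if_neg hli, sub_zero, ← Matrix.single_neg, gardingEnd_neg, add_mul, mul_add, smul_mul_assoc,
      mul_smul_comm, smul_add, smul_smul, hI, smul_neg, neg_smul, one_smul]
    module
  · subst hli
    simp only [if_true, if_neg hjk, zero_sub, ← Matrix.single_neg, gardingEnd_neg, add_mul, mul_add, smul_mul_assoc,
      mul_smul_comm, smul_add, smul_smul, hI, smul_neg, neg_smul, one_smul, neg_neg]
    module
  · simp only [if_neg hjk, if_neg hli, sub_zero, gardingEnd_zero, add_mul, mul_add, smul_mul_assoc, mul_smul_comm,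
      smul_add, smul_smul, hI, smul_zero, add_zero, neg_smul, one_smul]

/-! ### 2. Brackets of `E` and `τ(T)` with the `𝔭`-operators -/

/-- **`[E, P⁻] = P⁰`.** [cite: Knapp1986, Ch. VIII §3] -/
theorem raisingK_mul_pMinus :
    (Dh[0,1] - Da[1,0]) * (Dh[1,0] + Da[0,1]) =
      (Dh[1,0] + Da[0,1]) * (Dh[0,1] - Da[1,0]) + ((2 : ℂ) • (Dh[0,0] - Dh[1,1]) + (2 : ℂ) • (Da[0,0] - Da[1,1])) := by
  have hh := gardingEndHol_mul_eq (hcpt := hcpt) (τ := τ) hτ w 0 1 1 0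
  have ha := gardingEndAnti_mul_eq (hcpt := hcpt) (τ := τ) hτ w 1 0 0 1
  have c1 : Dh[0,1] * Da[0,1] = Da[0,1] * Dh[0,1] := gardingEndHol_comm_gardingEndAnti hτ w 0 1 0 1
  have c2 : Dh[1,0] * Da[1,0] = Da[1,0] * Dh[1,0] := gardingEndHol_comm_gardingEndAnti hτ w 1 0 1 0
  simp only [if_true] at hh ha
  set Ph : Module.End ℂ (archGardingSpace hcpt τ) := Dh[0,1]
  set Mh : Module.End ℂ (archGardingSpace hcpt τ) := Dh[1,0]
  set P : Module.End ℂ (archGardingSpace hcpt τ) := Da[0,1]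
  set M : Module.End ℂ (archGardingSpace hcpt τ) := Da[1,0]
  set H0 : Module.End ℂ (archGardingSpace hcpt τ) := Dh[0,0]
  set H1 : Module.End ℂ (archGardingSpace hcpt τ) := Dh[1,1]
  set A0 : Module.End ℂ (archGardingSpace hcpt τ) := Da[0,0]
  set A1 : Module.End ℂ (archGardingSpace hcpt τ) := Da[1,1]
  simp only [sub_mul, mul_add, add_mul, mul_sub]
  rw [hh, ha, c1, ← c2]
  module

/-- **`[E, P⁺] = 0`.** [cite: Knapp1986, Ch. VIII §3] -/
theorem raisingK_mul_pPlus :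
    (Dh[0,1] - Da[1,0]) * (Dh[0,1] + Da[1,0]) = (Dh[0,1] + Da[1,0]) * (Dh[0,1] - Da[1,0]) := by
  have c : Dh[0,1] * Da[1,0] = Da[1,0] * Dh[0,1] := gardingEndHol_comm_gardingEndAnti hτ w 0 1 1 0
  set Ph : Module.End ℂ (archGardingSpace hcpt τ) := Dh[0,1]
  set M : Module.End ℂ (archGardingSpace hcpt τ) := Da[1,0]
  simp only [sub_mul, mul_add, add_mul, mul_sub]
  rw [c]
  abel

/-- **`[E, P⁰] = -8 P⁺`.** [cite: Knapp1986, Ch. VIII §3] -/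
theorem raisingK_mul_pZero :
    (Dh[0,1] - Da[1,0]) * ((2 : ℂ) • (Dh[0,0] - Dh[1,1]) + (2 : ℂ) • (Da[0,0] - Da[1,1])) =
      ((2 : ℂ) • (Dh[0,0] - Dh[1,1]) + (2 : ℂ) • (Da[0,0] - Da[1,1])) * (Dh[0,1] - Da[1,0]) + (-8 : ℂ) • (Dh[0,1] + Da[1,0]) := by
  -- `[τ^h(E₀₀), τ^h(E₀₁)] = 2τ^h(E₀₁)`, `[τ^h(E₁₁), τ^h(E₀₁)] = -2τ^h(E₀₁)`, and the antiholomorphic analogues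
  have h1 := gardingEndHol_mul_eq (hcpt := hcpt) (τ := τ) hτ w 0 1 0 0
  have h2 := gardingEndHol_mul_eq (hcpt := hcpt) (τ := τ) hτ w 0 1 1 1
  have a1 := gardingEndAnti_mul_eq (hcpt := hcpt) (τ := τ) hτ w 1 0 0 0
  have a2 := gardingEndAnti_mul_eq (hcpt := hcpt) (τ := τ) hτ w 1 0 1 1
  simp only [if_true, show ((0 : Fin 2) = 1) = False from by simp, show ((1 : Fin 2) = 0) = False from by simp,
    if_false] at h1 h2 a1 a2
  have c1 : Dh[0,1] * Da[0,0] = Da[0,0] * Dh[0,1] := gardingEndHol_comm_gardingEndAnti hτ w 0 1 0 0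
  have c2 : Dh[0,1] * Da[1,1] = Da[1,1] * Dh[0,1] := gardingEndHol_comm_gardingEndAnti hτ w 0 1 1 1
  have c3 : Dh[0,0] * Da[1,0] = Da[1,0] * Dh[0,0] := gardingEndHol_comm_gardingEndAnti hτ w 0 0 1 0
  have c4 : Dh[1,1] * Da[1,0] = Da[1,0] * Dh[1,1] := gardingEndHol_comm_gardingEndAnti hτ w 1 1 1 0
  set Ph : Module.End ℂ (archGardingSpace hcpt τ) := Dh[0,1]
  set M : Module.End ℂ (archGardingSpace hcpt τ) := Da[1,0]
  set H0 : Module.End ℂ (archGardingSpace hcpt τ) := Dh[0,0]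
  set H1 : Module.End ℂ (archGardingSpace hcpt τ) := Dh[1,1]
  set A0 : Module.End ℂ (archGardingSpace hcpt τ) := Da[0,0]
  set A1 : Module.End ℂ (archGardingSpace hcpt τ) := Da[1,1]
  simp only [sub_mul, mul_add, add_mul, mul_sub, smul_sub, mul_smul_comm, smul_mul_assoc]
  rw [h1, h2, a1, a2, c1, c2, ← c3, ← c4]
  module

/-- `τ(T) = (i/2)((τ^h(E₀₀) - τ^h(E₁₁)) - (τ^a(E₀₀) - τ^a(E₁₁)))`. [folklore] -/
theorem gardingEnd_torusC_eq : D Tc = (Complex.I / 2) • ((Dh[0,0] - Dh[1,1]) - (Da[0,0] - Da[1,1])) := by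
  rw [holDiag_sub_antiDiag hτ w, smul_smul]
  rw [show Complex.I / 2 * (-2 * Complex.I) = 1 by
    rw [div_mul_eq_mul_div, show Complex.I * (-2 * Complex.I) = -2 * (Complex.I * Complex.I) by ring, Complex.I_mul_I]; norm_num,
    one_smul]

/-- **`[τ(T), P⁻] = -2i P⁻`.** [folklore] -/
theorem torusC_mul_pMinus :
    D Tc * (Dh[1,0] + Da[0,1]) = (Dh[1,0] + Da[0,1]) * D Tc + (-2 * Complex.I) • (Dh[1,0] + Da[0,1]) := by
  have h1 := gardingEndHol_mul_eq (hcpt := hcpt) (τ := τ) hτ w 0 0 1 0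
  have h2 := gardingEndHol_mul_eq (hcpt := hcpt) (τ := τ) hτ w 1 1 1 0
  have a1 := gardingEndAnti_mul_eq (hcpt := hcpt) (τ := τ) hτ w 0 0 0 1
  have a2 := gardingEndAnti_mul_eq (hcpt := hcpt) (τ := τ) hτ w 1 1 0 1
  simp only [if_true, show ((0 : Fin 2) = 1) = False from by simp, show ((1 : Fin 2) = 0) = False from by simp,
    if_false] at h1 h2 a1 a2
  have c1 : Dh[0,0] * Da[0,1] = Da[0,1] * Dh[0,0] := gardingEndHol_comm_gardingEndAnti hτ w 0 0 0 1
  have c2 : Dh[1,1] * Da[0,1] = Da[0,1] * Dh[1,1] := gardingEndHol_comm_gardingEndAnti hτ w 1 1 0 1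
  have c3 : Dh[1,0] * Da[0,0] = Da[0,0] * Dh[1,0] := gardingEndHol_comm_gardingEndAnti hτ w 1 0 0 0
  have c4 : Dh[1,0] * Da[1,1] = Da[1,1] * Dh[1,0] := gardingEndHol_comm_gardingEndAnti hτ w 1 0 1 1
  rw [gardingEnd_torusC_eq hτ w]
  set Mh : Module.End ℂ (archGardingSpace hcpt τ) := Dh[1,0]
  set P : Module.End ℂ (archGardingSpace hcpt τ) := Da[0,1]
  set H0 : Module.End ℂ (archGardingSpace hcpt τ) := Dh[0,0]
  set H1 : Module.End ℂ (archGardingSpace hcpt τ) := Dh[1,1]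
  set A0 : Module.End ℂ (archGardingSpace hcpt τ) := Da[0,0]
  set A1 : Module.End ℂ (archGardingSpace hcpt τ) := Da[1,1]
  simp only [sub_mul, mul_add, add_mul, mul_sub, smul_sub, smul_add, mul_smul_comm, smul_mul_assoc]
  rw [h1, h2, a1, a2, c1, c2, ← c3, ← c4]
  have hI : Complex.I * Complex.I = -1 := Complex.I_mul_I
  simp only [smul_add, smul_smul, zero_sub, sub_zero, smul_neg]
  rw [show Complex.I / 2 * 2 = Complex.I by ring]
  module

/-- **`[τ(T), P⁺] = 2i P⁺`.** [folklore] -/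
theorem torusC_mul_pPlus :
    D Tc * (Dh[0,1] + Da[1,0]) = (Dh[0,1] + Da[1,0]) * D Tc + (2 * Complex.I) • (Dh[0,1] + Da[1,0]) := by
  have h1 := gardingEndHol_mul_eq (hcpt := hcpt) (τ := τ) hτ w 0 0 0 1
  have h2 := gardingEndHol_mul_eq (hcpt := hcpt) (τ := τ) hτ w 1 1 0 1
  have a1 := gardingEndAnti_mul_eq (hcpt := hcpt) (τ := τ) hτ w 0 0 1 0
  have a2 := gardingEndAnti_mul_eq (hcpt := hcpt) (τ := τ) hτ w 1 1 1 0
  simp only [if_true, show ((0 : Fin 2) = 1) = False from by simp, show ((1 : Fin 2) = 0) = False from by simp,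
    if_false] at h1 h2 a1 a2
  have c1 : Dh[0,0] * Da[1,0] = Da[1,0] * Dh[0,0] := gardingEndHol_comm_gardingEndAnti hτ w 0 0 1 0
  have c2 : Dh[1,1] * Da[1,0] = Da[1,0] * Dh[1,1] := gardingEndHol_comm_gardingEndAnti hτ w 1 1 1 0
  have c3 : Dh[0,1] * Da[0,0] = Da[0,0] * Dh[0,1] := gardingEndHol_comm_gardingEndAnti hτ w 0 1 0 0
  have c4 : Dh[0,1] * Da[1,1] = Da[1,1] * Dh[0,1] := gardingEndHol_comm_gardingEndAnti hτ w 0 1 1 1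
  rw [gardingEnd_torusC_eq hτ w]
  set Ph : Module.End ℂ (archGardingSpace hcpt τ) := Dh[0,1]
  set M : Module.End ℂ (archGardingSpace hcpt τ) := Da[1,0]
  set H0 : Module.End ℂ (archGardingSpace hcpt τ) := Dh[0,0]
  set H1 : Module.End ℂ (archGardingSpace hcpt τ) := Dh[1,1]
  set A0 : Module.End ℂ (archGardingSpace hcpt τ) := Da[0,0]
  set A1 : Module.End ℂ (archGardingSpace hcpt τ) := Da[1,1]
  simp only [sub_mul, mul_add, add_mul, mul_sub, smul_sub, smul_add, mul_smul_comm, smul_mul_assoc]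
  rw [h1, h2, a1, a2, c1, c2, ← c3, ← c4]
  simp only [smul_add, smul_smul, zero_sub, sub_zero, smul_neg]
  rw [show Complex.I / 2 * 2 = Complex.I by ring]
  module

/-- **`[τ(T), P⁰] = 0`.** [folklore] -/
theorem torusC_mul_pZero :
    D Tc * ((2 : ℂ) • (Dh[0,0] - Dh[1,1]) + (2 : ℂ) • (Da[0,0] - Da[1,1])) =
      ((2 : ℂ) • (Dh[0,0] - Dh[1,1]) + (2 : ℂ) • (Da[0,0] - Da[1,1])) * D Tc := by
  have hc : Dh[1,1] * Dh[0,0] = Dh[0,0] * Dh[1,1] := gardingEndHol_hOne_mul_hZero hτ w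
  have ac : Da[1,1] * Da[0,0] = Da[0,0] * Da[1,1] := gardingEndAnti_hOne_mul_hZero hτ w
  have c1 : Dh[0,0] * Da[0,0] = Da[0,0] * Dh[0,0] := gardingEndHol_comm_gardingEndAnti hτ w 0 0 0 0
  have c2 : Dh[0,0] * Da[1,1] = Da[1,1] * Dh[0,0] := gardingEndHol_comm_gardingEndAnti hτ w 0 0 1 1
  have c3 : Dh[1,1] * Da[0,0] = Da[0,0] * Dh[1,1] := gardingEndHol_comm_gardingEndAnti hτ w 1 1 0 0
  have c4 : Dh[1,1] * Da[1,1] = Da[1,1] * Dh[1,1] := gardingEndHol_comm_gardingEndAnti hτ w 1 1 1 1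
  rw [gardingEnd_torusC_eq hτ w]
  set H0 : Module.End ℂ (archGardingSpace hcpt τ) := Dh[0,0]
  set H1 : Module.End ℂ (archGardingSpace hcpt τ) := Dh[1,1]
  set A0 : Module.End ℂ (archGardingSpace hcpt τ) := Da[0,0]
  set A1 : Module.End ℂ (archGardingSpace hcpt τ) := Da[1,1]
  simp only [sub_mul, mul_add, add_mul, mul_sub, smul_sub, smul_add, mul_smul_comm, smul_mul_assoc]
  rw [hc, ac, c1, c2, c3, c4]
  module

/-! ### 3. The descent vector -/

/-- **Descent of a highest-weight vector.** If `E x = 0`, `τ(T) x = im x` with `m ≠ 0, 1`, then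
`x' = P⁻ x - (4m)⁻¹ P⁰ F x - (4m(m-1))⁻¹ P⁺ F² x` satisfies `E x' = 0` and `τ(T) x' = i(m-2) x'`.
[cite: JacquetLanglands1970, §6] [cite: Knapp1986, Ch. VIII §3] -/
theorem descent_highest (m : ℂ) (hm : m ≠ 0) (hm1 : m - 1 ≠ 0) (x : archGardingSpace hcpt τ)
    (hE : (Dh[0,1] - Da[1,0]) x = 0) (hT : D Tc x = (Complex.I * m) • x) :
    (Dh[0,1] - Da[1,0]) ((Dh[1,0] + Da[0,1]) x - (1 / (4 * m)) • ((2 : ℂ) • (Dh[0,0] - Dh[1,1]) + (2 : ℂ) • (Da[0,0] - Da[1,1])) ((Dh[1,0] - Da[0,1]) x) -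
        (1 / (4 * m * (m - 1))) • (Dh[0,1] + Da[1,0]) ((Dh[1,0] - Da[0,1]) ((Dh[1,0] - Da[0,1]) x))) = 0 ∧
    D Tc ((Dh[1,0] + Da[0,1]) x - (1 / (4 * m)) • ((2 : ℂ) • (Dh[0,0] - Dh[1,1]) + (2 : ℂ) • (Da[0,0] - Da[1,1])) ((Dh[1,0] - Da[0,1]) x) -
        (1 / (4 * m * (m - 1))) • (Dh[0,1] + Da[1,0]) ((Dh[1,0] - Da[0,1]) ((Dh[1,0] - Da[0,1]) x))) =
      (Complex.I * (m - 2)) • ((Dh[1,0] + Da[0,1]) x - (1 / (4 * m)) • ((2 : ℂ) • (Dh[0,0] - Dh[1,1]) + (2 : ℂ) • (Da[0,0] - Da[1,1])) ((Dh[1,0] - Da[0,1]) x) -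
        (1 / (4 * m * (m - 1))) • (Dh[0,1] + Da[1,0]) ((Dh[1,0] - Da[0,1]) ((Dh[1,0] - Da[0,1]) x))) := by
  -- the string identities `E F x = 4m x`, `E F² x = 8(m-1) F x`
  have hs1 : (Dh[0,1] - Da[1,0]) ((Dh[1,0] - Da[0,1]) x) = (4 * m) • x := by
    have h := raisingK_loweringK_pow_succ_apply hτ w m x hE hT 0
    rw [zero_add, pow_one, pow_zero, Module.End.one_apply] at h
    rw [h]; congr 1; push_cast; ring
  have hs2 : (Dh[0,1] - Da[1,0]) ((Dh[1,0] - Da[0,1]) ((Dh[1,0] - Da[0,1]) x)) = (8 * (m - 1)) • (Dh[1,0] - Da[0,1]) x := by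
    have h := raisingK_loweringK_pow_succ_apply hτ w m x hE hT 1
    rw [pow_succ, pow_one, Module.End.mul_apply] at h
    rw [h]; congr 1; push_cast; ring
  -- weights of `F x`, `F² x`
  have hw1 : D Tc ((Dh[1,0] - Da[0,1]) x) = (Complex.I * (m - 2)) • (Dh[1,0] - Da[0,1]) x := by
    have h := torusC_loweringK_pow_apply hτ w m x hT 1
    rw [pow_one] at h
    rw [h]; congr 1; push_cast; ring
  have hw2 : D Tc ((Dh[1,0] - Da[0,1]) ((Dh[1,0] - Da[0,1]) x)) = (Complex.I * (m - 4)) • (Dh[1,0] - Da[0,1]) ((Dh[1,0] - Da[0,1]) x) := by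
    have h := torusC_loweringK_pow_apply hτ w m x hT 2
    rw [pow_succ, pow_one, Module.End.mul_apply] at h
    rw [h]; congr 1; push_cast; ring
  set EK : Module.End ℂ (archGardingSpace hcpt τ) := Dh[0,1] - Da[1,0] with hEK
  set FK : Module.End ℂ (archGardingSpace hcpt τ) := Dh[1,0] - Da[0,1] with hFK
  set PM : Module.End ℂ (archGardingSpace hcpt τ) := Dh[1,0] + Da[0,1] with hPM
  set PZ : Module.End ℂ (archGardingSpace hcpt τ) := (2 : ℂ) • (Dh[0,0] - Dh[1,1]) + (2 : ℂ) • (Da[0,0] - Da[1,1]) with hPZ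
  set PP : Module.End ℂ (archGardingSpace hcpt τ) := Dh[0,1] + Da[1,0] with hPP
  set T : Module.End ℂ (archGardingSpace hcpt τ) := D Tc with hTd
  -- bracket relations applied to vectors (definitional unfoldings of `mul_apply`, `add_apply`, `smul_apply`)
  have bM : ∀ v : archGardingSpace hcpt τ, EK (PM v) = PM (EK v) + PZ v := fun v =>
    LinearMap.congr_fun (raisingK_mul_pMinus (hcpt := hcpt) (τ := τ) hτ w) v
  have bZ : ∀ v : archGardingSpace hcpt τ, EK (PZ v) = PZ (EK v) + (-8 : ℂ) • PP v := fun v =>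
    LinearMap.congr_fun (raisingK_mul_pZero (hcpt := hcpt) (τ := τ) hτ w) v
  have bP : ∀ v : archGardingSpace hcpt τ, EK (PP v) = PP (EK v) := fun v =>
    LinearMap.congr_fun (raisingK_mul_pPlus (hcpt := hcpt) (τ := τ) hτ w) v
  have tM : ∀ v : archGardingSpace hcpt τ, T (PM v) = PM (T v) + (-2 * Complex.I) • PM v := fun v =>
    LinearMap.congr_fun (torusC_mul_pMinus (hcpt := hcpt) (τ := τ) hτ w) v
  have tZ : ∀ v : archGardingSpace hcpt τ, T (PZ v) = PZ (T v) := fun v =>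
    LinearMap.congr_fun (torusC_mul_pZero (hcpt := hcpt) (τ := τ) hτ w) v
  have tP : ∀ v : archGardingSpace hcpt τ, T (PP v) = PP (T v) + (2 * Complex.I) • PP v := fun v =>
    LinearMap.congr_fun (torusC_mul_pPlus (hcpt := hcpt) (τ := τ) hτ w) v
  refine ⟨?_, ?_⟩
  · rw [map_sub, map_sub, map_smul, map_smul, bM, hE, map_zero, zero_add, bZ, hs1, map_smul, bP, hs2, map_smul]
    have h4 : (1 / (4 * m)) • ((4 * m) • PZ x) = PZ x := by
      rw [smul_smul, one_div, inv_mul_cancel₀ (mul_ne_zero (by norm_num) hm), one_smul]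
    have h8 : (1 / (4 * m * (m - 1))) • ((8 * (m - 1)) • PP (FK x)) = (2 / m) • PP (FK x) := by
      rw [smul_smul]; congr 1; field_simp; ring
    rw [smul_add, h4, h8, smul_smul]
    rw [show 1 / (4 * m) * -8 = -(2 / m) by field_simp; ring, neg_smul]
    abel
  · rw [map_sub, map_sub, map_smul, map_smul, tM, hT, map_smul, tZ, hw1, map_smul, tP, hw2, map_smul]
    module

/-! ### 4. Weights of highest-weight vectors are natural numbers -/

/-- **In a finite-dimensional `K_∞`-stable subspace, a non-zero highest-weight vector has weight
`m ∈ ℕ`, its string `F^j x` (`j ≤ m`) is non-zero and `F^{m+1} x = 0`.** [cite: Knapp1986, Ch. II §5] -/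
theorem exists_nat_weight_of_highest {V : Submodule ℂ (archGardingSpace hcpt τ)} [FiniteDimensional ℂ V]
    (hK : ∀ κ ∈ Kinf 2 K, ∀ v ∈ V, gardingAct hτ κ v ∈ V) {x : archGardingSpace hcpt τ} (hxV : x ∈ V) (hx : x ≠ 0)
    (hE : (Dh[0,1] - Da[1,0]) x = 0) {c : ℂ} (hT : D Tc x = c • x) :
    ∃ m : ℕ, c = Complex.I * m ∧ ((Dh[1,0] - Da[0,1]) ^ (m + 1)) x = 0 ∧ ∀ j ≤ m, ((Dh[1,0] - Da[0,1]) ^ j) x ≠ 0 := by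
  have hst := star_letters (K := K)
  -- `F` and `τ(T)` preserve `V`
  have hFV : ∀ v ∈ V, (Dh[1,0] - Da[0,1]) v ∈ V := by
    intro v hv
    have h := LinearMap.congr_fun (raisingK_loweringK_eq (hcpt := hcpt) (τ := τ) hτ w).2 v
    rw [h, LinearMap.sub_apply, LinearMap.neg_apply, LinearMap.smul_apply]
    exact V.sub_mem (V.neg_mem (gardingEnd_mem_of_kStable hτ hK (hst.2.2.1 w) hv))
      (V.smul_mem _ (gardingEnd_mem_of_kStable hτ hK (hst.2.2.2 w) hv))
  have hTV : ∀ v ∈ V, D Tc v ∈ V := fun v hv => gardingEnd_mem_of_kStable hτ hK (hst.2.1 w) hv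
  set R : Module.End ℂ V := (Dh[1,0] - Da[0,1]).restrict hFV with hR
  set DT : Module.End ℂ V := (D Tc).restrict hTV with hDT
  have hDR : DT * R = R * DT + (-2 * Complex.I) • R := by
    refine LinearMap.ext fun v => Subtype.ext ?_
    exact LinearMap.congr_fun (torusC_mul_loweringK (hcpt := hcpt) (τ := τ) hτ w) (v : archGardingSpace hcpt τ)
  have hx' : (⟨x, hxV⟩ : V) ≠ 0 := fun h => hx (congrArg Subtype.val h)
  have hT' : DT ⟨x, hxV⟩ = c • ⟨x, hxV⟩ := by
    apply Subtype.ext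
    simp only [hDT, LinearMap.restrict_apply, Submodule.coe_smul]
    exact hT
  obtain ⟨j, hj0, hj1, -⟩ := exists_pow_apply_ne_zero_and_pow_succ_apply_eq_zero DT R
    (mul_ne_zero (by norm_num) Complex.I_ne_zero) hDR hx' hT'
  have hpow : ∀ n : ℕ, (((R ^ n) ⟨x, hxV⟩ : V) : archGardingSpace hcpt τ) = ((Dh[1,0] - Da[0,1]) ^ n) x := by
    intro n
    induction n with
    | zero => simp
    | succ n ih => rw [pow_succ', Module.End.mul_apply, pow_succ', Module.End.mul_apply, ← ih, hR, LinearMap.restrict_apply]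
  have hj0' : ((Dh[1,0] - Da[0,1]) ^ j) x ≠ 0 := by
    rw [← hpow]; exact fun h => hj0 (Subtype.ext h)
  have hj1' : ((Dh[1,0] - Da[0,1]) ^ (j + 1)) x = 0 := by
    rw [← hpow, hj1]; rfl
  -- the string identity forces `c = ij`
  have hIc : c = Complex.I * (-Complex.I * c) := by linear_combination c * Complex.I_sq
  have hT2 : D Tc x = (Complex.I * (-Complex.I * c)) • x := by rw [hT, ← hIc]
  have hs := raisingK_loweringK_pow_succ_apply hτ w (-Complex.I * c) x hE hT2 j
  rw [hj1', map_zero] at hs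
  have hcoef : (4 * ((j : ℂ) + 1) * (-Complex.I * c - j)) = 0 := by
    by_contra hne
    exact hj0' ((smul_eq_zero.mp hs.symm).resolve_left hne)
  have hc : c = Complex.I * j := by
    have h1 : (4 * ((j : ℂ) + 1)) ≠ 0 := mul_ne_zero (by norm_num) (by exact_mod_cast Nat.succ_ne_zero j)
    have h2 : -Complex.I * c - j = 0 := (mul_eq_zero.mp hcoef).resolve_left h1
    rw [hIc, sub_eq_zero.mp h2]
  refine ⟨j, hc, hj1', fun i hi h0 => hj0' ?_⟩
  obtain ⟨d, rfl⟩ := Nat.exists_eq_add_of_le' hi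
  rw [pow_add, Module.End.mul_apply, h0, map_zero]

end Place

end Literature.NumberTheory.Automorphic
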